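/-
Copyright (c) 2026 the pub-hodgecm-mathlib formalisation cell (harness21).  Prover seat hodgecm-mathlib-LH4-p08 (g8), req620 Track A «(D-RAM) FOUR-FRAME» squad, helper lane
on h413 = stmt-HodgeConjecture-24833 (count-neutral).  STAGE-1b, row (2) cone road (LH4-p07 (g9) ★ p859832 pattern «the cut weld does not see the scaled multiplier's alive
shift», type U).  2026-09-04.
-/
import Summits.HodgeConjecture.HodgeConjecture.Theorems.F0P3cDyRamToricCensusSumUnrV5Cutoff     -- ★ p859859 (this seat): `toricCensusSum_unr_v5_cutoff`
import Summits.HodgeConjecture.HodgeConjecture.Theorems.F0P3cDyRamToricCensusSumRamKCutOffset   -- ★ p859832 (LH4-p07 (g9)): `cutSum_eq_of_agree_below_alive` (type-free; reused, not restated)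
import HarnessLib

/-!
# Crux `H413`, line LH4 «(D-RAM) FOUR-FRAME» — STAGE-1b, row (2): (T5-P-coneΔ-R2)-Unr, ALIVE OFFSET «THE TYPE-U CUT SUM DOES NOT SEE THE SCALED MULTIPLIER'S ALIVE SHIFT»
# `hvTopP∕M` with `2j + d ≤ 2jl + 1 + e` in place of `2j + d ≤ 2jl + 1`, cutoff `C + d ≤ m + jl + 1` ⇒ the cut sum has ★ p859859's value VERBATIM

Cell `hodgecm-mathlib` (D-0151), FLOOR 0, crux item H413 = `stmt-HodgeConjecture-24833`, route of record `HCCMUnconditional`; squad F0∕P3c∕LH4 (req618∕req620); helper lane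
`--supports stmt-HodgeConjecture-24833 --as helper` (count-neutral).  THEOREMS ONLY (no `def`, no instance, no notation, no `sorry`; default heartbeats).  Pure finite-sum
bookkeeping over `ℚ` on ABSTRACT tables.

THE POINT (LH4-p07 (g9), ★ p859832 for RamK; this is the type-U twin).  The cone cells of a template piece `lev_{a′,b′}` are the cells of the SCALED multiplier
`μ₁ = (jE c)⁻¹(lam − jE u₀₀)` (★ p859713); their off-diagonal ∕ low tables are the unit's at `μ₁`'s tokens (type-free ★ T5a (D0)–(D2)), but the TOP cells' alive law is a
law of the twist `κ = ρμ∕μ = ρμ₁∕μ₁` read against the UNSCALED conductor, so in `μ₁`'s tokens the sheet-v5 `hvTop` sentences carry the alive conjunct `2j + d ≤ 2jl₁ + 1 + e`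
with an OFFSET `e` (= `a′`, the (D3♯) organ's to prove).  THIS FILE shows the offset is invisible to the type-U CUT sum: under `C + d ≤ m + jl + 1` (near `1`: `b′ − 2a′ ≥ d − 1`,
true for `sq_{m*}`, `lev_{ℓ₀,m*}`, `lev_{ℓ₀+1,m*}`) every top cell inside the cutoff has `2j + d ≤ 2jl + 1`, so the tables may be re-cut at the standard boundary without changing
the cut sum (★ `cutSum_eq_of_agree_below_alive`, imported), and ★ p859859 `toricCensusSum_unr_v5_cutoff` applies:
* **`toricCensusSum_unr_v5_cutoff_offset`** — ★ p859859's binders with `hvTopP ∕ hvTopM ↦ (e : ℕ) hvTopPE ∕ hvTopME` (alive `2j + d ≤ 2jl + 1 + e`) + `(hCe : C + d ≤ m + jl + 1)`;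
  conclusion CHARACTER-IDENTICAL to ★ p859859's.  Proof: re-cut tables `wP∕wM`, ★ `cutSum_eq_of_agree_below_alive`, ★ p859859.
The flipped-class twin (★ p859860 minus the bands, with the offset) follows the same two steps.
HONEST LABEL.  Count-neutral (`--supports`); the value of `e` for the pieces is NOT asserted here; no census LAW is stated; pays no registered stub and touches no `Lines/`
module; the seven tier-0 ED. 5 sorries stay OPEN; `HC_CM` is proved only modulo the 7 printed citations (2 remaining named inputs: hLiu418 = `stmt-HodgeConjecture-24832`,
h413 = `stmt-HodgeConjecture-24833`) until rung 0 closes.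

## References
* [Kottwitz1986BaseChangeUnits] R. E. Kottwitz, *Base change for unit elements of Hecke algebras*, Compositio Math. 60 (1986), §1 pp. 240–241.
* [Rogawski1990] J. D. Rogawski, *Automorphic Representations of Unitary Groups in Three Variables*, Ann. of Math. Stud. 123 (1990), §4.9 Prop. 4.9.1 (b) p. 55, Lemma 4.9.3 p. 56.
* [Flicker1998UnitaryFL] Y. Z. Flicker, *Elementary proof of the fundamental lemma for a unitary group*, Canad. J. Math. 50 (1998), Prop. 7 p. 84 (the level tables).
-/

set_option autoImplicit false

namespace Summit.HodgeConjecture.HodgeConjecture.Cruxes.H413.F0P3cDyRamToricCensusSumUnrV5CutoffOffset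

open Finset
open Summit.HodgeConjecture.HodgeConjecture.Cruxes.H413.F0P3cDyRamToricCensusSumUnrV5Cutoff (toricCensusSum_unr_v5_cutoff)
open Summit.HodgeConjecture.HodgeConjecture.Cruxes.H413.F0P3cDyRamToricCensusSumRamKCutOffset (cutSum_eq_of_agree_below_alive)

/-- **(T5-P-coneΔ-R2)-Unr WITH AN ALIVE OFFSET.**  ★ p859859 `toricCensusSum_unr_v5_cutoff`'s binders with the top rows' alive condition SHIFTED to `2j + d ≤ 2jl + 1 + e`
(`hvTopPE ∕ hvTopME`, any `e : ℕ`; the cells of a scaled multiplier are alive up to the unscaled conductor), a cutoff `C` with `jl ≤ C` and `C + d ≤ m + jl + 1` (the offset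
band is cut): the cut sum has ★ p859859's value VERBATIM (★ T5s-v5 value minus the two cut top bands). [cite: Kottwitz1986BaseChangeUnits, §1 pp. 240–241]
[cite: Rogawski1990, §4.9 Prop. 4.9.1 (b) p. 55, Lemma 4.9.3 p. 56] [cite: Flicker1998UnitaryFL, Prop. 7 p. 84] -/
theorem toricCensusSum_unr_v5_cutoff_offset (q : ℕ) {d jl m : ℕ} (ε : ℚ) (hq : 2 ≤ q) (hd : 2 ≤ d) (hjl : jl % 2 = 0) (hmS : d - d % 2 ≤ m + 1)
    (hreal : (ε = 1 ∧ m % 2 = d % 2 ∧ 1 ≤ m ∧ m + d ≤ jl) ∨ (ε = -1 ∧ m = jl - d + 1 ∧ d ≤ jl))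
    (nP nM vP vM : ℕ → ℕ → ℚ)
    (hnP : ∀ j a, 1 ≤ a → nP j a = if a + d ≤ j ∧ (j - a - d) % 2 = 0 then ((q : ℚ) ^ 2 - 1) * (q : ℚ) ^ (j - 2 - (j - a - d) / 2) else 0)
    (hnP0 : ∀ j, nP j 0 = if (j + d) % 2 = 0 then (if d ≤ j then ((q : ℚ) + 1) * (q : ℚ) ^ ((j + d) / 2 - 1) else (if j = 0 then 1 else ((q : ℚ) + 1) * (q : ℚ) ^ (j - 1))) else 0)
    (hnM : ∀ j a, nM j a = if (d ≤ j + 1 ∧ a + d = j + 1) ∨ (j + 1 < d ∧ a = 0 ∧ (j + d) % 2 = 1) then (if j = 0 then 1 else ((q : ℚ) + 1) * (q : ℚ) ^ (j - 1)) else 0)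
    (hv0 : ∀ j, vP j 0 = nP j 0 ∧ vM j 0 = nM j 0)
    (hvOff : ∀ j a, 1 ≤ a → j + m ≠ jl + a →
      (vP j a = if 2 * a ≤ m ∧ (j + a ≤ m ∨ j + a ≤ jl) then nP j a else 0) ∧ (vM j a = if 2 * a ≤ m ∧ (j + a ≤ m ∨ j + a ≤ jl) then nM j a else 0))
    (hvLow : ∀ j a, 1 ≤ a → j + m = jl + a → 2 * a ≤ m → vP j a = nP j a ∧ vM j a = nM j a)
    (e : ℕ)
    (hvTopPE : ∀ j a, 1 ≤ a → j + m = jl + a → m < 2 * a →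
      vP j a = if (d + m ≤ jl ∧ (jl - d - m) % 2 = 0) ∧ 2 * j + d ≤ 2 * jl + 1 + e then nP j a / (((q : ℚ) - 1) * (q : ℚ) ^ ((2 * a - m + 1) / 2 - 1)) else 0)
    (hvTopME : ∀ j a, 1 ≤ a → j + m = jl + a → m < 2 * a →
      vM j a = if jl + 1 = d + m ∧ 2 * j + d ≤ 2 * jl + 1 + e then nM j a / (q : ℚ) ^ ((2 * a - m) / 2) else 0)
    (C : ℕ) (hC : jl ≤ C) (hCe : C + d ≤ m + jl + 1) :
    ε * ∑ j ∈ range (jl + 1), ∑ a ∈ range (jl + 2), (q : ℚ) ^ a * (if j + a ≤ C then vP j a - vM j a else 0) =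
      (q : ℚ) ^ m * ((1 + ((q : ℚ) + 1) * ∑ i ∈ range (jl / 2), (q : ℚ) ^ i) - 2 * ∑ i ∈ range (d - d % 2), (q : ℚ) ^ i)
      - (if m + d ≤ jl ∧ (jl - m - d) % 2 = 0 then
          ((q : ℚ) + 1) * (q : ℚ) ^ (((C + m - jl) / 2 + 1) + d + (jl - m - d) / 2 + m / 2 - 1) *
            ∑ i ∈ range (((2 * m + 1 - d) / 2 + 1) - ((C + m - jl) / 2 + 1)), (q : ℚ) ^ i
        else 0)
      - (if jl + 1 = d + m then
          ((q : ℚ) + 1) * (q : ℚ) ^ (((C + m - jl) / 2 + 1) + d + m - m / 2 - 2) *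
            ∑ i ∈ range (((2 * m + 1 - d) / 2 + 1) - ((C + m - jl) / 2 + 1)), (q : ℚ) ^ i
        else 0) := by
  classical
  -- the standard-alive tables: the given ones, re-cut at `2j + d ≤ 2jl + 1` on the top diagonal
  set wP : ℕ → ℕ → ℚ := fun j a => if 1 ≤ a ∧ j + m = jl + a ∧ m < 2 * a then
      (if (d + m ≤ jl ∧ (jl - d - m) % 2 = 0) ∧ 2 * j + d ≤ 2 * jl + 1 then nP j a / (((q : ℚ) - 1) * (q : ℚ) ^ ((2 * a - m + 1) / 2 - 1)) else 0)
    else vP j a with hwP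
  set wM : ℕ → ℕ → ℚ := fun j a => if 1 ≤ a ∧ j + m = jl + a ∧ m < 2 * a then
      (if jl + 1 = d + m ∧ 2 * j + d ≤ 2 * jl + 1 then nM j a / (q : ℚ) ^ ((2 * a - m) / 2) else 0)
    else vM j a with hwM
  have hw0 : ∀ j, wP j 0 = nP j 0 ∧ wM j 0 = nM j 0 := fun j => by
    obtain ⟨h1, h2⟩ := hv0 j
    rw [hwP, hwM]; dsimp only
    rw [if_neg (show ¬ (1 ≤ 0 ∧ j + m = jl + 0 ∧ m < 2 * 0) from fun h => by omega),
      if_neg (show ¬ (1 ≤ 0 ∧ j + m = jl + 0 ∧ m < 2 * 0) from fun h => by omega), h1, h2]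
    exact ⟨rfl, rfl⟩
  have hwOff : ∀ j a, 1 ≤ a → j + m ≠ jl + a →
      (wP j a = if 2 * a ≤ m ∧ (j + a ≤ m ∨ j + a ≤ jl) then nP j a else 0) ∧ (wM j a = if 2 * a ≤ m ∧ (j + a ≤ m ∨ j + a ≤ jl) then nM j a else 0) :=
    fun j a ha hoff => by
    obtain ⟨h1, h2⟩ := hvOff j a ha hoff
    rw [hwP, hwM]; dsimp only
    rw [if_neg (show ¬ (1 ≤ a ∧ j + m = jl + a ∧ m < 2 * a) from fun h => hoff h.2.1),
      if_neg (show ¬ (1 ≤ a ∧ j + m = jl + a ∧ m < 2 * a) from fun h => hoff h.2.1), h1, h2]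
    exact ⟨rfl, rfl⟩
  have hwLow : ∀ j a, 1 ≤ a → j + m = jl + a → 2 * a ≤ m → wP j a = nP j a ∧ wM j a = nM j a := fun j a ha hdiag hlow => by
    obtain ⟨h1, h2⟩ := hvLow j a ha hdiag hlow
    rw [hwP, hwM]; dsimp only
    rw [if_neg (show ¬ (1 ≤ a ∧ j + m = jl + a ∧ m < 2 * a) from fun h => by omega),
      if_neg (show ¬ (1 ≤ a ∧ j + m = jl + a ∧ m < 2 * a) from fun h => by omega), h1, h2]
    exact ⟨rfl, rfl⟩
  have hwTopP : ∀ j a, 1 ≤ a → j + m = jl + a → m < 2 * a →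
      wP j a = if (d + m ≤ jl ∧ (jl - d - m) % 2 = 0) ∧ 2 * j + d ≤ 2 * jl + 1 then nP j a / (((q : ℚ) - 1) * (q : ℚ) ^ ((2 * a - m + 1) / 2 - 1)) else 0 :=
    fun j a ha hdiag htop => by
    rw [hwP]; dsimp only
    rw [if_pos ⟨ha, hdiag, htop⟩]
  have hwTopM : ∀ j a, 1 ≤ a → j + m = jl + a → m < 2 * a →
      wM j a = if jl + 1 = d + m ∧ 2 * j + d ≤ 2 * jl + 1 then nM j a / (q : ℚ) ^ ((2 * a - m) / 2) else 0 :=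
    fun j a ha hdiag htop => by
    rw [hwM]; dsimp only
    rw [if_pos ⟨ha, hdiag, htop⟩]
  -- the two cut sums agree: the tables differ only on top cells beyond the standard alive boundary, and those are cut
  have hagree : ∀ j a, ¬ (j + m = jl + a ∧ 2 * jl + 1 < 2 * j + d) → vP j a = wP j a ∧ vM j a = wM j a := fun j a hna => by
    rw [hwP, hwM]; dsimp only
    by_cases hcase : 1 ≤ a ∧ j + m = jl + a ∧ m < 2 * a
    · rw [if_pos hcase, if_pos hcase, hvTopPE j a hcase.1 hcase.2.1 hcase.2.2, hvTopME j a hcase.1 hcase.2.1 hcase.2.2]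
      have halive : 2 * j + d ≤ 2 * jl + 1 := by
        by_contra hlt
        exact hna ⟨hcase.2.1, by omega⟩
      have hiffP : ((d + m ≤ jl ∧ (jl - d - m) % 2 = 0) ∧ 2 * j + d ≤ 2 * jl + 1 + e) ↔ ((d + m ≤ jl ∧ (jl - d - m) % 2 = 0) ∧ 2 * j + d ≤ 2 * jl + 1) := by
        constructor <;> rintro ⟨h1, h2⟩ <;> exact ⟨h1, by omega⟩
      have hiffM : (jl + 1 = d + m ∧ 2 * j + d ≤ 2 * jl + 1 + e) ↔ (jl + 1 = d + m ∧ 2 * j + d ≤ 2 * jl + 1) := by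
        constructor <;> rintro ⟨h1, h2⟩ <;> exact ⟨h1, by omega⟩
      rw [if_congr hiffP rfl rfl, if_congr hiffM rfl rfl]
      exact ⟨rfl, rfl⟩
    · rw [if_neg hcase, if_neg hcase]
      exact ⟨rfl, rfl⟩
  rw [cutSum_eq_of_agree_below_alive (q : ℚ) hCe vP vM wP wM hagree]
  exact toricCensusSum_unr_v5_cutoff q ε hq hd hjl hmS hreal nP nM wP wM hnP hnP0 hnM hw0 hwOff hwLow hwTopP hwTopM C hC

end Summit.HodgeConjecture.HodgeConjecture.Cruxes.H413.F0P3cDyRamToricCensusSumUnrV5CutoffOffset
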